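import Mathlib.Analysis.Matrix.HermitianFunctionalCalculus
import Mathlib.Analysis.SpecialFunctions.Complex.Arctan
import Mathlib.Analysis.SpecificLimits.Basic
import Literature.MathematicalPhysics.QuantumLattice.DuhamelTwoPoint

/-!
# Locality of the arctan kernel of a range-one Hermitian matrix

Stub `stub_arctanKernelLocality` for the line `weyl-window` of
`Summit.QuantumFields.QCD.Theses.SpectralDefectExtinction.ExtinctionBuildsQCD`
(crux `ExtinctionBuildsQCD`, item stmt-QuantumFields-8968).

The line `weyl-window` controls the sign of the Wilson fermion determinant through the sign
matrix of the Hermitian Wilson–Dirac operator, via the Aizenman–Graf representation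
(M. Aizenman, G. M. Graf, *Localization bounds for an electron gas*, J. Phys. A 31 (1998) 6783)
`sgn(H) = (1/π) PV∫_{|η| ≤ Y} (H − iη)⁻¹ dη + (2/π) arctan(H/Y)`.
This file provides the deterministic large-`|η|` tail of that representation: for a Hermitian
matrix `H` on a finite index type `ι` carrying a pseudo-distance `d` (zero on the diagonal,
triangle inequality), with spectrum in `[-b, b]` and range one (`H p q = 0` when `d p q > 1`),
the kernel of `arctan(H/(2b))` is exponentially local:
`‖arctan(H/(2b)) x y‖ ≤ 2 · 2^{-d(x,y)}`.

Proof: `arctan(H/Y)`, `Y = 2b`, is the norm-convergent odd power series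
`∑ₙ (-1)ⁿ (H/Y)^{2n+1}/(2n+1)` (ratio `≤ 1/2`), read off entrywise in an eigenbasis of `H` from
the real series `Real.hasSum_arctan`; the `n`-th term has `(x,y)` entry of norm `≤ (1/2)^{2n+1}`
(rows of the eigenvector unitary have unit norm) and vanishes when `2n+1 < d(x,y)` because
`(Hᵐ) x y = 0` for `m < d(x,y)` (range one + triangle inequality).  Summing the geometric tail
from the first surviving index gives `(4/3)(1/2)^{d(x,y)} ≤ 2 (1/2)^{d(x,y)}`.
-/

noncomputable section

open Finset

namespace Summit.QuantumFields.QCD.Cruxes.ExtinctionBuildsQCD.WeylWindow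

/-! ### Eigenbasis bookkeeping -/

/-- Entries of `V diag(w) V⋆`: `(V diag(w) V⋆) x y = ∑ᵢ V x i · w i · conj (V y i)`. -/
private theorem conj_diagonal_apply {ι : Type*} [Fintype ι] [DecidableEq ι] (V : Matrix ι ι ℂ)
    (w : ι → ℂ) (x y : ι) :
    (V * Matrix.diagonal w * star V) x y = ∑ i, V x i * w i * star (V y i) := by
  rw [Matrix.mul_apply]
  refine sum_congr rfl fun i _ => ?_
  rw [Matrix.mul_diagonal, Matrix.star_eq_conjTranspose, Matrix.conjTranspose_apply]

/-- Powers in the eigenbasis: `H ^ m = U diag(λᵢ ^ m) U⋆`. -/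
private theorem pow_eq_conj_diagonal {ι : Type*} [Fintype ι] [DecidableEq ι] {H : Matrix ι ι ℂ}
    (hH : H.IsHermitian) (m : ℕ) :
    H ^ m = (hH.eigenvectorUnitary : Matrix ι ι ℂ) *
      Matrix.diagonal (fun i => (hH.eigenvalues i : ℂ) ^ m) *
        star (hH.eigenvectorUnitary : Matrix ι ι ℂ) := by
  have hU : (hH.eigenvectorUnitary : Matrix ι ι ℂ) ∈ unitary (Matrix ι ι ℂ) :=
    hH.eigenvectorUnitary.prop
  induction m with
  | zero =>
    simp only [pow_zero, Matrix.diagonal_one, Matrix.mul_one]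
    exact (Unitary.mul_star_self_of_mem hU).symm
  | succ m ih =>
    calc H ^ (m + 1) = H ^ m * H := pow_succ H m
    _ = (hH.eigenvectorUnitary : Matrix ι ι ℂ) *
          Matrix.diagonal (fun i => (hH.eigenvalues i : ℂ) ^ m) *
            star (hH.eigenvectorUnitary : Matrix ι ι ℂ) *
          ((hH.eigenvectorUnitary : Matrix ι ι ℂ) *
            Matrix.diagonal (fun i => (hH.eigenvalues i : ℂ)) *
              star (hH.eigenvectorUnitary : Matrix ι ι ℂ)) := by
        rw [← ih, ← hH.eq_conj_diagonal]
    _ = (hH.eigenvectorUnitary : Matrix ι ι ℂ) *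
          (Matrix.diagonal (fun i => (hH.eigenvalues i : ℂ) ^ m) *
            Matrix.diagonal (fun i => (hH.eigenvalues i : ℂ))) *
            star (hH.eigenvectorUnitary : Matrix ι ι ℂ) := by
        simp only [Matrix.mul_assoc]
        rw [← Matrix.mul_assoc (star (hH.eigenvectorUnitary : Matrix ι ι ℂ)),
          Unitary.star_mul_self_of_mem hU, Matrix.one_mul]
    _ = _ := by
        rw [Matrix.diagonal_mul_diagonal]
        simp only [pow_succ]

/-- Powers of a range-one matrix: `(H ^ n) p q = 0` whenever `n < d p q`, for a pseudo-distance
`d` vanishing on the diagonal and satisfying the triangle inequality. -/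
private theorem pow_apply_eq_zero_of_lt {ι : Type*} [Fintype ι] [DecidableEq ι] (d : ι → ι → ℕ)
    (hd0 : ∀ p, d p p = 0) (htri : ∀ p q r, d p r ≤ d p q + d q r) (H : Matrix ι ι ℂ)
    (hH : ∀ p q, 1 < d p q → H p q = 0) :
    ∀ (n : ℕ) (p q : ι), n < d p q → (H ^ n) p q = 0 := by
  intro n
  induction n with
  | zero =>
    intro p q hpq
    have hne : p ≠ q := by
      rintro rfl
      rw [hd0] at hpq
      exact Nat.lt_irrefl 0 hpq
    rw [pow_zero, Matrix.one_apply_ne hne]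
  | succ n ih =>
    intro p q hpq
    rw [pow_succ, Matrix.mul_apply]
    refine sum_eq_zero fun r _ => ?_
    by_cases hrq : 1 < d r q
    · rw [hH r q hrq, mul_zero]
    · have := htri p r q
      rw [ih p r (by omega), zero_mul]

/-! ### Scalar estimates -/

/-- The `n`-th term of the `arctan` series at a ratio `|u| ≤ 1/2` has absolute value
`≤ (1/2)^{2n+1}`. -/
private theorem arctan_term_abs_le {u : ℝ} (hu : |u| ≤ 1 / 2) (n : ℕ) :
    |(-1 : ℝ) ^ n * u ^ (2 * n + 1) / ((2 * n + 1 : ℕ) : ℝ)| ≤ (1 / 2 : ℝ) ^ (2 * n + 1) := by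
  rw [abs_div, abs_mul, abs_pow, abs_pow, abs_neg, abs_one, one_pow, one_mul, Nat.abs_cast]
  calc |u| ^ (2 * n + 1) / ((2 * n + 1 : ℕ) : ℝ) ≤ |u| ^ (2 * n + 1) :=
        div_le_self (pow_nonneg (abs_nonneg _) _) (by norm_cast; omega)
    _ ≤ (1 / 2 : ℝ) ^ (2 * n + 1) := pow_le_pow_left₀ (abs_nonneg _) hu _

/-- Rows of a unitary matrix are unit vectors, so `∑ᵢ ‖V x i‖ ‖V y i‖ ≤ 1`. -/
private theorem sum_norm_mul_norm_le_one {ι : Type*} [Fintype ι] [DecidableEq ι]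
    {V : Matrix ι ι ℂ} (hV : V ∈ unitary (Matrix ι ι ℂ)) (x y : ι) :
    ∑ i, ‖V x i‖ * ‖V y i‖ ≤ 1 := by
  have h1 := Matrix.sum_norm_sq_row_eq_one hV x
  have h2 := Matrix.sum_norm_sq_row_eq_one hV y
  calc ∑ i, ‖V x i‖ * ‖V y i‖ ≤ ∑ i, (‖V x i‖ ^ 2 + ‖V y i‖ ^ 2) / 2 :=
        sum_le_sum fun i _ => by nlinarith [two_mul_le_add_sq ‖V x i‖ ‖V y i‖]
    _ = 1 := by rw [← sum_div, sum_add_distrib, h1, h2]; norm_num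

/-! ### Main statement -/

/-- **Locality of the arctan kernel of a range-one Hermitian matrix.**  For a Hermitian matrix
`H` on a finite index type with a pseudo-distance `d` (zero diagonal, symmetric, triangle
inequality), with eigenvalues in `[-b, b]` and range one, the `(x, y)` entry of
`arctan (H / (2b))` is bounded by `2 · (1/2) ^ d x y`. -/
theorem stub_arctanKernelLocality :
    ∀ (ι : Type) [Fintype ι] [DecidableEq ι] (d : ι → ι → ℕ), (∀ p, d p p = 0) →
      (∀ p q, d p q = d q p) → (∀ p q r, d p r ≤ d p q + d q r) →
      ∀ (H : Matrix ι ι ℂ) (hH : H.IsHermitian) (b : ℝ), 0 < b → (∀ i, |hH.eigenvalues i| ≤ b) →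
      (∀ p q, 1 < d p q → H p q = 0) →
      ∀ x y : ι, ‖(cfc (fun t : ℝ => Real.arctan (t / (2 * b))) H) x y‖ ≤ 2 * (1 / 2) ^ d x y := by
  intro ι _ _ d hd0 _hsymm htri H hH b hb hbd hrange x y
  -- notation
  set U : Matrix ι ι ℂ := (hH.eigenvectorUnitary : Matrix ι ι ℂ) with hUdef
  have hU : U ∈ unitary (Matrix ι ι ℂ) := hH.eigenvectorUnitary.prop
  -- the eigenvalue ratios `λ i / (2b)` have absolute value `≤ 1/2`
  have hu : ∀ i, |hH.eigenvalues i / (2 * b)| ≤ 1 / 2 := by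
    intro i
    rw [abs_div, abs_of_pos (by positivity : (0 : ℝ) < 2 * b),
      div_le_iff₀ (by positivity : (0 : ℝ) < 2 * b)]
    linarith [hbd i]
  have hu1 : ∀ i, ‖hH.eigenvalues i / (2 * b)‖ < 1 := fun i => by
    rw [Real.norm_eq_abs]; linarith [hu i]
  -- the `n`-th term of the series, entry `(x, y)`
  set term : ℕ → ℂ := fun n => ∑ i, U x i *
    (((-1 : ℝ) ^ n * (hH.eigenvalues i / (2 * b)) ^ (2 * n + 1) / ((2 * n + 1 : ℕ) : ℝ) : ℝ) : ℂ) *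
      star (U y i) with hterm_def
  -- (A) the series sums to the kernel entry
  have hHas : HasSum term ((cfc (fun t : ℝ => Real.arctan (t / (2 * b))) H) x y) := by
    rw [hH.cfc_eq_conj_diagonal, ← hUdef, conj_diagonal_apply]
    refine hasSum_sum fun i _ => ?_
    exact ((Complex.hasSum_ofReal.mpr (Real.hasSum_arctan (hu1 i))).mul_left (U x i)).mul_right
      (star (U y i))
  -- (B) term bound
  have hnorm : ∀ n, ‖term n‖ ≤ (1 / 2 : ℝ) ^ (2 * n + 1) := by
    intro n
    calc ‖term n‖ ≤ ∑ i, ‖U x i * (((-1 : ℝ) ^ n * (hH.eigenvalues i / (2 * b)) ^ (2 * n + 1) /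
          ((2 * n + 1 : ℕ) : ℝ) : ℝ) : ℂ) * star (U y i)‖ := norm_sum_le _ _
      _ ≤ ∑ i, (1 / 2 : ℝ) ^ (2 * n + 1) * (‖U x i‖ * ‖U y i‖) := sum_le_sum fun i _ => by
          rw [norm_mul, norm_mul, norm_star, Complex.norm_real, Real.norm_eq_abs]
          have h1 := norm_nonneg (U x i)
          have h2 := norm_nonneg (U y i)
          have h3 := arctan_term_abs_le (hu i) n
          calc ‖U x i‖ * |(-1 : ℝ) ^ n * (hH.eigenvalues i / (2 * b)) ^ (2 * n + 1) /
                ((2 * n + 1 : ℕ) : ℝ)| * ‖U y i‖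
                = |(-1 : ℝ) ^ n * (hH.eigenvalues i / (2 * b)) ^ (2 * n + 1) /
                    ((2 * n + 1 : ℕ) : ℝ)| * (‖U x i‖ * ‖U y i‖) := by ring
            _ ≤ (1 / 2 : ℝ) ^ (2 * n + 1) * (‖U x i‖ * ‖U y i‖) :=
                mul_le_mul_of_nonneg_right h3 (mul_nonneg h1 h2)
      _ = (1 / 2 : ℝ) ^ (2 * n + 1) * ∑ i, ‖U x i‖ * ‖U y i‖ := by rw [mul_sum]
      _ ≤ (1 / 2 : ℝ) ^ (2 * n + 1) := by
          have h1 := sum_norm_mul_norm_le_one hU x y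
          have h2 : 0 ≤ (1 / 2 : ℝ) ^ (2 * n + 1) := by positivity
          nlinarith
  -- (Z) the low-order terms vanish
  have hvan : ∀ n, 2 * n + 1 < d x y → term n = 0 := by
    intro n hn
    have hz : (H ^ (2 * n + 1)) x y = 0 := pow_apply_eq_zero_of_lt d hd0 htri H hrange _ x y hn
    rw [pow_eq_conj_diagonal hH, ← hUdef, conj_diagonal_apply] at hz
    have key : term n = ((-1 : ℂ) ^ n / (2 * (b : ℂ)) ^ (2 * n + 1) / ((2 * n + 1 : ℕ) : ℂ)) *
        ∑ i, U x i * (hH.eigenvalues i : ℂ) ^ (2 * n + 1) * star (U y i) := by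
      simp only [hterm_def, mul_sum]
      refine sum_congr rfl fun i _ => ?_
      rw [div_pow]
      push_cast
      ring
    rw [key, hz, mul_zero]
  -- assemble: shift the series past the vanishing terms and compare with a geometric series
  set n₀ : ℕ := d x y / 2 with hn₀
  have hlt : ∀ n, n < n₀ → 2 * n + 1 < d x y := by omega
  have hle : d x y ≤ 2 * n₀ + 1 := by omega
  have hHas' : HasSum (fun k => term (k + n₀))
      ((cfc (fun t : ℝ => Real.arctan (t / (2 * b))) H) x y) := by
    have := (hasSum_nat_add_iff' n₀).mpr hHas
    rwa [sum_eq_zero (fun i hi => hvan i (hlt i (mem_range.mp hi))), sub_zero] at this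
  have hgeom : HasSum (fun k : ℕ => (1 / 2 : ℝ) ^ (2 * n₀ + 1) * (1 / 4 : ℝ) ^ k)
      ((1 / 2 : ℝ) ^ (2 * n₀ + 1) * (1 - 1 / 4)⁻¹) :=
    (hasSum_geometric_of_lt_one (by norm_num) (by norm_num)).mul_left _
  have hbound : ∀ k, ‖term (k + n₀)‖ ≤ (1 / 2 : ℝ) ^ (2 * n₀ + 1) * (1 / 4 : ℝ) ^ k := fun k => by
    refine (hnorm (k + n₀)).trans (le_of_eq ?_)
    rw [show 2 * (k + n₀) + 1 = 2 * n₀ + 1 + 2 * k by ring, pow_add, pow_mul]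
    norm_num
  have h1 : (1 / 2 : ℝ) ^ (2 * n₀ + 1) ≤ (1 / 2) ^ d x y :=
    pow_le_pow_of_le_one (by norm_num) (by norm_num) hle
  have h2 : (0 : ℝ) ≤ (1 / 2 : ℝ) ^ d x y := by positivity
  calc ‖(cfc (fun t : ℝ => Real.arctan (t / (2 * b))) H) x y‖
      ≤ (1 / 2 : ℝ) ^ (2 * n₀ + 1) * (1 - 1 / 4)⁻¹ := hHas'.norm_le_of_bounded hgeom hbound
    _ ≤ 2 * (1 / 2) ^ d x y := by norm_num; nlinarith

end Summit.QuantumFields.QCD.Cruxes.ExtinctionBuildsQCD.WeylWindow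

end
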